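import Summits.KontsevichZagierPeriods.KontsevichZagierPeriods.Theorems.EllipticMomentKernel.Negative.Roots

/-!
# `EllipticMomentKernel` (stmt-KontsevichZagierPeriods-10631) — negative knowledge, part 7: honest generators for every admissible parameter

`isSemialgebraic_oval` (from the quantifier-free `oval_eq_setOf`, no Tarski–Seidenberg),
`isSemialgebraicFunOn_genIntegrandQ`, integrability of `x^m/√f` on the oval by domination with
`d/dx arcsin((2x − e₃ − e₂)/(e₂ − e₃))` (`integrableOn_genIntegrand_of_roots`), the honest
representations `genRepQ h m : IntegralRep 1 ∈ gens₁ q₂ q₃`, and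
`gens_nonempty : 0 < disc → (gens q₂ q₃).Nonempty` — the generator set of the crux is inhabited at
every admissible parameter, by representations of genuine (non-zero under `Rigid`) periods:
the crux is nowhere true for want of representations. [folklore]
-/

noncomputable section

open MeasureTheory Set
open scoped BigOperators

namespace Summit.KontsevichZagierPeriods.HermiteRigidity.EllipticMomentKernelNegative

open Literature.NumberTheory.Transcendental
open Literature.NumberTheory.Transcendental.KZ
open Summit.KontsevichZagierPeriods.KontsevichZagierPeriods.Theses.HermiteRigidity (EllipticMomentKernel)

section GeneralCurve

open Literature.ModelTheory.ExponentialFields (IsSemialgebraic isSemialgebraic_setOf_eval_pos)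
open MvPolynomial (aeval X C)


variable {q₂ q₃ : ℚ}

/-- The general cubic as a `ℚ`-polynomial. [folklore] -/
def cubicPolyQ (q₂ q₃ : ℚ) : MvPolynomial (Fin 1) ℚ := 4 * X 0 ^ 3 - C q₂ * X 0 - C q₃

/-- Evaluation of `cubicPolyQ`. [folklore] -/
theorem aeval_cubicPolyQ (p : Fin 1 → ℝ) : aeval p (cubicPolyQ q₂ q₃) = cubic q₂ q₃ (p 0) := by
  simp [cubicPolyQ, cubic, map_ofNat]

/-- **`σ` is `ℚ`-semialgebraic for every admissible parameter** (no Tarski–Seidenberg: the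
quantifier-free description `oval_eq_setOf`). [folklore] -/
theorem isSemialgebraic_oval (h : 0 < disc q₂ q₃) : IsSemialgebraic ℚ (oval q₂ q₃) := by
  rw [oval_eq_setOf h]
  have h1 := isSemialgebraic_setOf_eval_pos (k := ℚ) (R := ℝ) (cubicPolyQ q₂ q₃)
  have h2 := isSemialgebraic_setOf_eval_pos (k := ℚ) (R := ℝ) (-X 0 : MvPolynomial (Fin 1) ℚ)
  have h3 := isSemialgebraic_setOf_eval_pos (k := ℚ) (R := ℝ)
    (C q₂ - 12 * X 0 ^ 2 : MvPolynomial (Fin 1) ℚ)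
  convert h1.inter (h2.union h3) using 1
  ext p
  simp only [mem_setOf_eq, mem_inter_iff, mem_union, aeval_cubicPolyQ, map_neg,
    MvPolynomial.aeval_X, map_sub, map_mul, MvPolynomial.aeval_C, map_pow, eq_ratCast,
    map_ofNat]
  constructor
  · rintro ⟨hp, hx | hx⟩
    · exact ⟨hp, Or.inl (by linarith)⟩
    · exact ⟨hp, Or.inr (by linarith)⟩
  · rintro ⟨hp, hx | hx⟩
    · exact ⟨hp, Or.inl (by linarith)⟩
    · exact ⟨hp, Or.inr (by linarith)⟩

/-- The generator integrands are `ℚ`-semialgebraic on `σ` for every admissible parameter.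
[cite: BochnakCosteRoy1998, Prop. 2.2.6] -/
theorem isSemialgebraicFunOn_genIntegrandQ (h : 0 < disc q₂ q₃) (m : ℕ) :
    IsSemialgebraicFunOn ℚ (oval q₂ q₃) (fun p => p 0 ^ m / Real.sqrt (cubic q₂ q₃ (p 0))) := by
  have hs := isSemialgebraic_oval h
  have h1 : IsSemialgebraicFunOn ℚ (oval q₂ q₃)
      (fun p => aeval p (X 0 ^ m : MvPolynomial (Fin 1) ℚ)) := isSemialgebraicFunOn_aeval hs _
  have h2 : IsSemialgebraicFunOn ℚ (oval q₂ q₃)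
      (fun p => aeval p (1 : MvPolynomial (Fin 1) ℚ) / aeval p (cubicPolyQ q₂ q₃)) :=
    isSemialgebraicFunOn_aeval_div_aeval hs _ _ fun p hp => by
      rw [aeval_cubicPolyQ]; exact hp.1.ne'
  have h4 := IsSemialgebraicFunOn.mul_holds h1 (IsSemialgebraicFunOn.sqrt_holds h2)
  refine h4.congr fun p hp => ?_
  simp only [Pi.mul_apply, map_pow, MvPolynomial.aeval_X, map_one, aeval_cubicPolyQ]
  rw [Real.sqrt_div' _ hp.1.le, Real.sqrt_one, mul_one_div]

/-- `arcsin ((2x − a − b)/(b − a))` is a primitive of `1/√((x − a)(b − x))` on `(a, b)`. [folklore] -/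
theorem hasDerivAt_arcsin_chord {a b x : ℝ} (hab : a < b) (hx : x ∈ Ioo a b) :
    HasDerivAt (fun x => Real.arcsin ((2 * x - a - b) / (b - a)))
      (1 / Real.sqrt ((x - a) * (b - x))) x := by
  obtain ⟨h1, h2⟩ := hx
  have hl : 0 < b - a := by linarith
  have hu1 : (2 * x - a - b) / (b - a) ≠ -1 := by
    rw [Ne, div_eq_iff hl.ne']; intro h; linarith
  have hu2 : (2 * x - a - b) / (b - a) ≠ 1 := by
    rw [Ne, div_eq_iff hl.ne']; intro h; linarith
  have hlin : HasDerivAt (fun x : ℝ => (2 * x - a - b) / (b - a)) (2 / (b - a)) x := by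
    have := (((hasDerivAt_id x).const_mul 2).sub_const a).sub_const b |>.div_const (b - a)
    simpa using this
  have h := (Real.hasDerivAt_arcsin hu1 hu2).comp x hlin
  have hq : 0 < (x - a) * (b - x) := mul_pos (by linarith) (by linarith)
  have hsq : Real.sqrt (1 - ((2 * x - a - b) / (b - a)) ^ 2) =
      2 * Real.sqrt ((x - a) * (b - x)) / (b - a) := by
    have : 1 - ((2 * x - a - b) / (b - a)) ^ 2 = (2 / (b - a)) ^ 2 * ((x - a) * (b - x)) := by
      field_simp; ring
    rw [this, Real.sqrt_mul (by positivity) ((x - a) * (b - x)), Real.sqrt_sq (by positivity)]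
    ring
  have hpos : 0 < Real.sqrt ((x - a) * (b - x)) := Real.sqrt_pos.2 hq
  refine h.congr_deriv ?_
  rw [hsq]
  field_simp

/-- `1/√((x − a)(b − x))` is integrable on `(a, b)` (non-negative derivative of a continuous
function). [folklore] -/
theorem integrableOn_inv_sqrt_chord {a b : ℝ} (hab : a < b) :
    IntegrableOn (fun x : ℝ => 1 / Real.sqrt ((x - a) * (b - x))) (Ioo a b) := by
  have hcont : ContinuousOn (fun x : ℝ => Real.arcsin ((2 * x - a - b) / (b - a))) (Icc a b) :=
    (Real.continuous_arcsin.comp (by fun_prop)).continuousOn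
  have h := intervalIntegral.integrableOn_deriv_of_nonneg hcont
    (fun x hx => hasDerivAt_arcsin_chord hab hx) (fun x _ => by positivity)
  exact h.mono_set Ioo_subset_Ioc_self

/-- **`x^m/√f` is integrable on `(e₃, e₂)` for every cubic with three real roots**: on the oval
`f ≥ 4(e₁ − e₂)·(x − e₃)(e₂ − x)`, so `|x^m/√f| ≤ M^m/(2√(e₁ − e₂)) · 1/√((x − e₃)(e₂ − x))` with
`M = max |e₃| |e₂|`. [folklore] -/
theorem integrableOn_genIntegrand_of_roots {e₃ e₂ e₁ : ℝ} (h32 : e₃ < e₂) (h21 : e₂ < e₁)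
    (hf : ∀ x, cubic q₂ q₃ x = 4 * (x - e₃) * (x - e₂) * (x - e₁)) (m : ℕ) :
    IntegrableOn (fun x : ℝ => x ^ m / Real.sqrt (cubic q₂ q₃ x)) (Ioo e₃ e₂) := by
  set M : ℝ := max |e₃| |e₂| with hM
  set Cst : ℝ := M ^ m / (2 * Real.sqrt (e₁ - e₂)) with hC
  have hd : 0 < e₁ - e₂ := by linarith
  have hsd : 0 < Real.sqrt (e₁ - e₂) := Real.sqrt_pos.2 hd
  refine Integrable.mono' ((integrableOn_inv_sqrt_chord h32).const_mul Cst) ?_ ?_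
  · refine ContinuousOn.aestronglyMeasurable ?_ measurableSet_Ioo
    refine ContinuousOn.div (by fun_prop) (Real.continuous_sqrt.comp continuous_cubic).continuousOn
      fun x hx => (Real.sqrt_pos.2 ((cubic_sign_of_roots h32 h21 hf).1 x hx)).ne'
  · refine ae_restrict_of_forall_mem measurableSet_Ioo fun x hx => ?_
    obtain ⟨h1, h2⟩ := hx
    have hq : 0 < (x - e₃) * (e₂ - x) := mul_pos (by linarith) (by linarith)
    have hfx : 0 < cubic q₂ q₃ x := (cubic_sign_of_roots h32 h21 hf).1 x ⟨h1, h2⟩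
    have hsf : 0 < Real.sqrt (cubic q₂ q₃ x) := Real.sqrt_pos.2 hfx
    have hsq : 0 < Real.sqrt ((x - e₃) * (e₂ - x)) := Real.sqrt_pos.2 hq
    rw [Real.norm_eq_abs, abs_div, abs_of_pos hsf, abs_pow]
    have hxM : |x| ≤ M := by
      rw [abs_le]
      constructor
      · have : -M ≤ -|e₃| := neg_le_neg (le_max_left _ _)
        linarith [neg_abs_le e₃]
      · exact le_trans (le_trans h2.le (le_abs_self e₂)) (le_max_right _ _)
    have hM0 : 0 ≤ M := le_trans (abs_nonneg _) (le_max_left _ _)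
    have hxm : |x| ^ m ≤ M ^ m := pow_le_pow_left₀ (abs_nonneg x) hxM m
    have hlow : 4 * (e₁ - e₂) * ((x - e₃) * (e₂ - x)) ≤ cubic q₂ q₃ x := by
      rw [hf, show 4 * (x - e₃) * (x - e₂) * (x - e₁) = 4 * (e₁ - x) * ((x - e₃) * (e₂ - x)) by ring]
      have : e₁ - e₂ ≤ e₁ - x := by linarith
      nlinarith
    have hsfq : 2 * Real.sqrt (e₁ - e₂) * Real.sqrt ((x - e₃) * (e₂ - x)) ≤
        Real.sqrt (cubic q₂ q₃ x) := by
      have : 2 * Real.sqrt (e₁ - e₂) * Real.sqrt ((x - e₃) * (e₂ - x)) =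
          Real.sqrt (4 * (e₁ - e₂) * ((x - e₃) * (e₂ - x))) := by
        rw [Real.sqrt_mul (by positivity) ((x - e₃) * (e₂ - x)),
          Real.sqrt_mul (by norm_num) (e₁ - e₂),
          show (4 : ℝ) = 2 ^ 2 by norm_num, Real.sqrt_sq (by norm_num)]
      rw [this]
      exact Real.sqrt_le_sqrt hlow
    calc |x| ^ m / Real.sqrt (cubic q₂ q₃ x) ≤ M ^ m / Real.sqrt (cubic q₂ q₃ x) :=
          div_le_div_of_nonneg_right hxm hsf.le
      _ ≤ M ^ m / (2 * Real.sqrt (e₁ - e₂) * Real.sqrt ((x - e₃) * (e₂ - x))) :=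
          div_le_div_of_nonneg_left (pow_nonneg hM0 m) (by positivity) hsfq
      _ = Cst * (1 / Real.sqrt ((x - e₃) * (e₂ - x))) := by
          simp only [hC]; field_simp

/-- Integrability of the generator integrands on `σ ⊆ ℝ¹` for every admissible parameter.
[folklore] -/
theorem integrableOn_genIntegrandQ_oval (h : 0 < disc q₂ q₃) (m : ℕ) :
    IntegrableOn (fun p : Fin 1 → ℝ => p 0 ^ m / Real.sqrt (cubic q₂ q₃ (p 0))) (oval q₂ q₃) := by
  obtain ⟨e₃, e₂, e₁, h3, h2a, h2b, h1, hf⟩ := exists_roots h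
  have h32 : e₃ < e₂ := by linarith
  have h21 : e₂ < e₁ := by linarith
  have hset : oval q₂ q₃ = e1 ⁻¹' Ioo e₃ e₂ := by
    rw [oval_eq_of_roots h32 h21 hf]; ext p; simp
  rw [hset]
  exact (measurePreserving_e1.integrableOn_comp_preimage e1.measurableEmbedding).mpr
    (integrableOn_genIntegrand_of_roots h32 h21 hf m)

/-- **Honest generators for every admissible parameter**: `[σ, x^m/√f]` as an `IntegralRep 1`.
[cite: KontsevichZagier2001, §1.1] -/
def genRepQ (h : 0 < disc q₂ q₃) (m : ℕ) : IntegralRep 1 where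
  domain := oval q₂ q₃
  integrand := fun p => p 0 ^ m / Real.sqrt (cubic q₂ q₃ (p 0))
  isSemialgebraic_domain := isSemialgebraic_oval h
  isSemialgebraicFunOn_integrand := isSemialgebraicFunOn_genIntegrandQ h m
  integrableOn := integrableOn_genIntegrandQ_oval h m

/-- `[genRepQ h m] ∈ gens₁ q₂ q₃`. [folklore] -/
theorem of_genRepQ_mem_gens₁ (h : 0 < disc q₂ q₃) (m : ℕ) : KZ.of (genRepQ h m) ∈ gens₁ q₂ q₃ :=
  ⟨genRepQ h m, m, rfl, fun _ _ => rfl, rfl⟩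

/-- **The generator set of the crux is inhabited for EVERY admissible `(q₂, q₃)`** — the crux is
nowhere true for want of representations; with `value_pos_of_gens₂`/`J0_ne_zero_of_rigid` its
kernel claim is about genuine periods. [folklore] -/
theorem gens_nonempty (h : 0 < disc q₂ q₃) : (gens q₂ q₃).Nonempty :=
  ⟨_, Or.inr (of_genRepQ_mem_gens₁ h 0)⟩

/-- The value of `genRepQ h 0` is `J₀`, which rigidity makes non-zero: under the hypotheses of the
crux the sector contains a representation of a non-zero (indeed transcendental, by Schneider)
period. [folklore] -/
theorem value_genRepQ_zero (h : 0 < disc q₂ q₃) : (genRepQ h 0).value = J0 q₂ q₃ := by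
  simp [IntegralRep.value, genRepQ, J0]

end GeneralCurve

end Summit.KontsevichZagierPeriods.HermiteRigidity.EllipticMomentKernelNegative
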